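import Summits.CriticalPhenomena.PercolationContinuityZ3.Theorems.PercNearOneGluingNoHeavyLowerTailSahiCTCRtThreeRowOneAtoms
import Summits.CriticalPhenomena.PercolationContinuityZ3.Theorems.PercNearOneGluingNoHeavyLowerTailSahiCTCRtThreeLocalWindow
import HarnessLib

/-!
# `NoHeavyLowerTail` (crux stmt-CriticalPhenomena-4575), P3 lane: ROW 1 (ONE DOUBLED POINT) OF `R_3 ∈ ℕ[s]` REDUCED TO A LOCAL INEQUALITY ON
# EVERY 3-SUBSET OF `σ` — bulk/window split of the three Kleitman atom sums and localisation of all window terms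

Support file (seat `prim-l12-p3`, gen 51; `--supports stmt-CriticalPhenomena-4575`).  Memo
`run/shared/lean/prim/prim-l12/FROM-prim-l12-p3-g51-ROW0-ALL-K-LEAN.md` §5 (row-1 twin of `…RtThreeWindowReduction` + `…RtThreeLocalWindow`).

From `…RtThreeRowOneAtoms.coeff_ind_add_single_two_Rt_three_eq_atomSums` (`B_1` = three atom sums + pivot + window terms):
* `atomSum_window_three` (3-set twin of `atomSum_window_eq_sum_powersetCard`), `sum_pairsAt_eq_sum_powersetCard_three` (small pairs on the 3-sets,
  hypothesis `#P + #P' ≤ 3`), `pairsAt_union_right`, `coeff_theta_PiP_gf` (`[s^σ] Θ·(Π·GF K) = Σ_S pairsAt Θ K (σ∖S)`), `coeff_ie_eq_pairsAt` (for up-sets the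
  pivot term is `Σ_S pairsAt Θ₁ M_{<3} + Σ_S pairsAt Θ₁ M_{≥3}`, `M = (X¹∩Z¹)∖(X⁰∪Z⁰)`), `atomSum_split_four`;
* **`coeff_rowOne_nonneg_of_local`** : for up-sets `𝒳, 𝒵`, `d ∉ σ`, `#σ ≥ 3`: if on every 3-subset `Q ⊆ σ` the LOCAL quantity (three local atom sums of
  `(X¹,Z¹), (X⁰,Z¹), (X¹,Z⁰)` with the Kleitman tables `W_n`, `W¹_n` restricted to tops with `≤ 3` points and divided by `C(#σ−t, 3−t)`, plus the localised
  pivot pairs `(Θ₁, M_{<3})`, minus the localised window pairs `(Θ₂, Y¹¹_{<2})`, `(Θ₁, Y⁰⁰_{<3})`, `(Θ₁, Y¹¹_{<2})`, plus the localised crossing pairs) is `≥ 0`,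
  then `coeff_{1_σ+2e_d} R_3(𝒳,𝒵) ≥ 0` (atoms with `≥ 4` points in the top and pivot pairs with `#A ≥ 3` are dropped, being `≥ 0`).
What remains for ROW 1 in the tree is the finite check of this local inequality on `Fin 3` (+ the `d`-flags), exactly as `…RtThreeWindowFourCheck` did
for row 0: python (memo §5, code/gen51/row1lean_poly.py) — for all `123²` admissible trace pairs the local quantity times `2n(n−1)⋯(n−5)` is an integer
polynomial of degree `≤ 7` whose Taylor coefficients at `n = 5` are all `≥ 0`, and it is `≥ 0` at `n = 4, 5` — so it holds for every `#σ ≥ 4`.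
No new definitions; nothing is asserted about the crux.
-/

noncomputable section

open scoped Classical

namespace Summit.CriticalPhenomena.PercolationContinuityZ3.Theorems.SahiCTCForms

open Finset MvPolynomial SahiCTCGenFun

variable {α : Type*} [DecidableEq α]

/-! ## ROW 1: bulk/window split and localisation onto the 3-subsets of `σ` -/

section WindowThree
variable (wJ wX wOx wOz wOO : ℕ → ℕ → ℕ → ℚ)

/-- **THE 3-POINT WINDOW**: if the five tables vanish unless `a + b + c ≤ 3`, then for `#V ≥ 3`
`atomSum w 𝒳 𝒵 V = Σ_{Q ⊆ V, #Q = 3} atomSum (w / C(#V−(a+b+c), 3−(a+b+c))) 𝒳 𝒵 Q` (twin of `atomSum_window_eq_sum_powersetCard`). [this work] -/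
theorem atomSum_window_three (V : Finset α) (F G : Finset (Finset α))
    (hJ : ∀ a b c, 3 < a + b + c → wJ a b c = 0) (hX : ∀ a b c, 3 < a + b + c → wX a b c = 0)
    (hOx : ∀ a b c, 3 < a + b + c → wOx a b c = 0) (hOz : ∀ a b c, 3 < a + b + c → wOz a b c = 0)
    (hOO : ∀ a b c, 3 < a + b + c → wOO a b c = 0) (hV : 3 ≤ #V) :
    atomSum wJ wX wOx wOz wOO F G V =
      ∑ Q ∈ V.powersetCard 3, atomSum
        (fun a b c => wJ a b c / (((#V - (a + b + c)).choose (3 - (a + b + c)) : ℕ) : ℚ))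
        (fun a b c => wX a b c / (((#V - (a + b + c)).choose (3 - (a + b + c)) : ℕ) : ℚ))
        (fun a b c => wOx a b c / (((#V - (a + b + c)).choose (3 - (a + b + c)) : ℕ) : ℚ))
        (fun a b c => wOz a b c / (((#V - (a + b + c)).choose (3 - (a + b + c)) : ℕ) : ℚ))
        (fun a b c => wOO a b c / (((#V - (a + b + c)).choose (3 - (a + b + c)) : ℕ) : ℚ)) F G Q := by
  rw [sum_powersetCard_atomSum]
  unfold atomSum
  refine sum_congr rfl fun A _ => sum_congr rfl fun u _ => sum_congr rfl fun B _ => sum_congr rfl fun v _ => ?_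
  congr 1
  have key : ∀ (w : ℕ → ℕ → ℕ → ℚ), (∀ a b c, 3 < a + b + c → w a b c = 0) → ∀ a b c,
      (if a + b + c ≤ 3 then (((#V - (a + b + c)).choose (3 - (a + b + c)) : ℕ) : ℚ) else 0) *
        (w a b c / (((#V - (a + b + c)).choose (3 - (a + b + c)) : ℕ) : ℚ)) = w a b c := by
    intro w hw a b c
    by_cases h : a + b + c ≤ 3
    · rw [if_pos h]
      have hpos : 0 < (#V - (a + b + c)).choose (3 - (a + b + c)) := Nat.choose_pos (by omega)
      have hne : ((((#V - (a + b + c)).choose (3 - (a + b + c)) : ℕ) : ℚ)) ≠ 0 := by positivity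
      field_simp
    · rw [if_neg h, zero_mul, hw a b c (by omega)]
  unfold atomΩ
  split_ifs
  · exact (key wJ hJ _ _ _).symm
  · exact (key wX hX _ _ _).symm
  · exact (key wOx hOx _ _ _).symm
  · exact (key wOz hOz _ _ _).symm
  · exact (key wOO hOO _ _ _).symm

end WindowThree

/-- **Small pairs on the 3-sets**: if `#P + #P' ≤ 3` for all `P ∈ A`, `P' ∈ B`, then for `#V ≥ 3`
`Σ_{S ⊆ V} pairsAt A B (V∖S) = Σ_{Q ⊆ V, #Q = 3} Σ_{P,P' ⊆ Q} [P ∈ A][P' ∈ B][P ∩ P' = ∅] / C(#V − #(P ∪ P'), 3 − #(P ∪ P'))`. [this work] -/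
theorem sum_pairsAt_eq_sum_powersetCard_three (A B : Finset (Finset α)) (hAB : ∀ P ∈ A, ∀ P' ∈ B, #P + #P' ≤ 3) (V : Finset α) (hV : 3 ≤ #V) :
    ∑ S ∈ V.powerset, ((pairsAt A B (V \ S) : ℕ) : ℚ) =
      ∑ Q ∈ V.powersetCard 3, ∑ P ∈ Q.powerset, ∑ P' ∈ Q.powerset,
        ιq A P * ιq B P' * (if Disjoint P P' then 1 else 0) / (((#V - #(P ∪ P')).choose (3 - #(P ∪ P')) : ℕ) : ℚ) := by
  rw [sum_pairsAt_eq_sum_ind, sum_two_eq (V.powersetCard 3) V (fun Q hQ => (mem_powersetCard.1 hQ).1)]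
  refine sum_congr rfl fun P hP => sum_congr rfl fun P' hP' => ?_
  have hsub : P ∪ P' ⊆ V := union_subset (mem_powerset.1 hP) (mem_powerset.1 hP')
  rw [card_filter_powersetCard_superset V _ hsub 3]
  by_cases hPA : P ∈ A
  · by_cases hPB : P' ∈ B
    · have h3 : #(P ∪ P') ≤ 3 := (card_union_le P P').trans (hAB P hPA P' hPB)
      rw [if_pos h3]
      have hpos : 0 < (#V - #(P ∪ P')).choose (3 - #(P ∪ P')) := Nat.choose_pos (by omega)
      have hne : ((((#V - #(P ∪ P')).choose (3 - #(P ∪ P')) : ℕ) : ℚ)) ≠ 0 := by positivity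
      field_simp
    · simp [ιq, hPB]
  · simp [ιq, hPA]

omit [DecidableEq α] in
/-- `pairsAt` is additive in the second family over a disjoint union. [this work] -/
theorem pairsAt_union_right [DecidableEq α] (A B₁ B₂ : Finset (Finset α)) (h : Disjoint B₁ B₂) (W : Finset α) :
    pairsAt A (B₁ ∪ B₂) W = pairsAt A B₁ W + pairsAt A B₂ W := by
  unfold pairsAt
  rw [product_union, filter_union, card_union_of_disjoint]
  exact disjoint_left.2 fun p h1 h2 =>
    disjoint_left.1 h (mem_product.1 (mem_filter.1 h1).1).2 (mem_product.1 (mem_filter.1 h2).1).2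

/-- A window term `[s^σ] Θ·(Π·GF(K))` as small pairs: `= Σ_{S ⊆ σ} pairsAt Θ K (σ∖S)`. [this work] -/
theorem coeff_theta_PiP_gf (Θ K : Finset (Finset α)) (σ : Finset α) [Fintype α] :
    (gf Θ * (PiP * gf K)).coeff (ind σ) = ∑ S ∈ σ.powerset, (pairsAt Θ K (σ \ S) : ℤ) := by
  rw [mul_left_comm, coeff_ind_PiP_mul_gf_mul_gf]

/-- The pivot term for up-sets as small pairs, split by the size of the pivot set:
`[s^σ] Θ₁·Π·IE = Σ_S pairsAt Θ₁ M_{<3} (σ∖S) + Σ_S pairsAt Θ₁ M_{≥3} (σ∖S)`, `M = (X¹∩Z¹) ∖ (X⁰∪Z⁰)`. [this work] -/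
theorem coeff_ie_eq_pairsAt [Fintype α] {F G : Finset (Finset α)} (hF : IsUpperSet (F : Set (Finset α))) (hG : IsUpperSet (G : Set (Finset α)))
    (d : α) (σ : Finset α) :
    (gf (bySize (· < 2) : Finset (Finset α)) * (PiP *
        (gf (delV d F ∩ delV d G) + gf (linkV d F ∩ linkV d G) - gf (delV d F ∩ linkV d G) - gf (linkV d F ∩ delV d G)))).coeff (ind σ) =
      ∑ S ∈ σ.powerset, (pairsAt (bySize (· < 2) : Finset (Finset α)) (below 3 ((linkV d F ∩ linkV d G) \ (delV d F ∪ delV d G))) (σ \ S) : ℤ)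
      + ∑ S ∈ σ.powerset, (pairsAt (bySize (· < 2) : Finset (Finset α)) (atLeast 3 ((linkV d F ∩ linkV d G) \ (delV d F ∪ delV d G))) (σ \ S) : ℤ) := by
  rw [gf_ie_eq_gf_pivot (delV_subset_linkV_of_isUpperSet hF) (delV_subset_linkV_of_isUpperSet hG), coeff_theta_PiP_gf, ← sum_add_distrib]
  refine sum_congr rfl fun S _ => ?_
  rw [← Nat.cast_add, ← pairsAt_union_right]
  · congr 2
    ext T; simp only [below, atLeast, mem_union, mem_filter]; constructor
    · intro h; by_cases h3 : #T < 3; exacts [Or.inl ⟨h, h3⟩, Or.inr ⟨h, by omega⟩]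
    · rintro (⟨h, _⟩ | ⟨h, _⟩) <;> exact h
  · exact disjoint_left.2 fun T h1 h2 => by
      have := (mem_filter.1 h1).2; have := (mem_filter.1 h2).2; omega

/-! ## ROW 1 REDUCED TO A LOCAL INEQUALITY ON EVERY 3-SUBSET OF `σ` -/

/-- Splitting an atom sum with zero off-`J` tables by `[4 ≤ a+b+c]`. [this work] -/
theorem atomSum_split_four (w : ℕ → ℕ → ℕ → ℚ) (F G : Finset (Finset α)) (V : Finset α) :
    atomSum w (fun _ _ _ => 0) (fun _ _ _ => 0) (fun _ _ _ => 0) (fun _ _ _ => 0) F G V =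
      atomSum (fun a b c => if 4 ≤ a + b + c then w a b c else 0) (fun _ _ _ => 0) (fun _ _ _ => 0) (fun _ _ _ => 0) (fun _ _ _ => 0) F G V
      + atomSum (fun a b c => if 4 ≤ a + b + c then 0 else w a b c) (fun _ _ _ => 0) (fun _ _ _ => 0) (fun _ _ _ => 0) (fun _ _ _ => 0) F G V := by
  rw [← atomSum_add]
  unfold atomSum
  refine sum_congr rfl fun A _ => sum_congr rfl fun u _ => sum_congr rfl fun B _ => sum_congr rfl fun v _ => ?_
  congr 1
  unfold atomΩ
  by_cases h4 : 4 ≤ #(insert u A ∩ insert v B) + #(insert u A \ insert v B) + #(insert v B \ insert u A)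
  · simp only [h4, if_true, add_zero]
  · simp only [h4, if_false, zero_add, add_zero]

/-- **ROW 1 (ONE DOUBLED POINT) FROM A LOCAL INEQUALITY ON EVERY 3-SUBSET OF `σ`**: for up-sets `𝒳, 𝒵`, `d ∉ σ`, `#σ ≥ 3`: if for every
3-subset `Q ⊆ σ` the localised window quantity (three local atom sums of the deletions/links with the Kleitman tables `/ C(#σ−t, 3−t)`, the small
pivot pairs, minus the loop/common-edge window pairs, plus the crossing small pairs) is `≥ 0`, then `coeff_{1_σ + 2e_d} R_3(𝒳,𝒵) ≥ 0`.  The dropped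
terms (atoms with `≥ 4` points in the top corner, pivot pairs with a pivot set of `≥ 3` points) are `≥ 0`.  (Row-1 twin of
`…LocalWindow.coeff_ind_Rt_three_nonneg_of_local`; python: all `123²` trace pairs satisfy the hypothesis for every `#σ ≥ 4`, memo §5.) [this work] -/
theorem coeff_rowOne_nonneg_of_local [Fintype α] {F G : Finset (Finset α)} (hF : IsUpperSet (F : Set (Finset α)))
    (hG : IsUpperSet (G : Set (Finset α))) {σ : Finset α} {d : α} (hd : d ∉ σ) (hσ : 3 ≤ #σ)
    (hloc : ∀ Q ∈ σ.powersetCard 3, 0 ≤ atomSum (fun a b c => (if 4 ≤ a + b + c then 0 else ∑ t ∈ range 3, (((#σ - a - b - c).choose t : ℕ) : ℚ) *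
          (if b + c < #σ - t then ((((#σ - t : ℕ) : ℚ)) * ((((#σ - t - 1).choose (b + c) : ℕ) : ℚ)))⁻¹ else 0))
          / (((#σ - (a + b + c)).choose (3 - (a + b + c)) : ℕ) : ℚ))
        (fun a b c => (0 : ℚ) / (((#σ - (a + b + c)).choose (3 - (a + b + c)) : ℕ) : ℚ)) (fun a b c => (0 : ℚ) / (((#σ - (a + b + c)).choose (3 - (a + b + c)) : ℕ) : ℚ)) (fun a b c => (0 : ℚ) / (((#σ - (a + b + c)).choose (3 - (a + b + c)) : ℕ) : ℚ)) (fun a b c => (0 : ℚ) / (((#σ - (a + b + c)).choose (3 - (a + b + c)) : ℕ) : ℚ)) (linkV d F) (linkV d G) Q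
      + atomSum (fun a b c => (if 4 ≤ a + b + c then 0 else ∑ t ∈ range 2, (((#σ - a - b - c).choose t : ℕ) : ℚ) *
          (if b + c < #σ - t then ((((#σ - t : ℕ) : ℚ)) * ((((#σ - t - 1).choose (b + c) : ℕ) : ℚ)))⁻¹ else 0))
          / (((#σ - (a + b + c)).choose (3 - (a + b + c)) : ℕ) : ℚ))
        (fun a b c => (0 : ℚ) / (((#σ - (a + b + c)).choose (3 - (a + b + c)) : ℕ) : ℚ)) (fun a b c => (0 : ℚ) / (((#σ - (a + b + c)).choose (3 - (a + b + c)) : ℕ) : ℚ)) (fun a b c => (0 : ℚ) / (((#σ - (a + b + c)).choose (3 - (a + b + c)) : ℕ) : ℚ)) (fun a b c => (0 : ℚ) / (((#σ - (a + b + c)).choose (3 - (a + b + c)) : ℕ) : ℚ)) (delV d F) (linkV d G) Q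
      + atomSum (fun a b c => (if 4 ≤ a + b + c then 0 else ∑ t ∈ range 2, (((#σ - a - b - c).choose t : ℕ) : ℚ) *
          (if b + c < #σ - t then ((((#σ - t : ℕ) : ℚ)) * ((((#σ - t - 1).choose (b + c) : ℕ) : ℚ)))⁻¹ else 0))
          / (((#σ - (a + b + c)).choose (3 - (a + b + c)) : ℕ) : ℚ))
        (fun a b c => (0 : ℚ) / (((#σ - (a + b + c)).choose (3 - (a + b + c)) : ℕ) : ℚ)) (fun a b c => (0 : ℚ) / (((#σ - (a + b + c)).choose (3 - (a + b + c)) : ℕ) : ℚ)) (fun a b c => (0 : ℚ) / (((#σ - (a + b + c)).choose (3 - (a + b + c)) : ℕ) : ℚ)) (fun a b c => (0 : ℚ) / (((#σ - (a + b + c)).choose (3 - (a + b + c)) : ℕ) : ℚ)) (linkV d F) (delV d G) Q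
      + (∑ P ∈ Q.powerset, ∑ P' ∈ Q.powerset,
          ιq (bySize (· < 2) : Finset (Finset α)) P * ιq (below 3 (((linkV d F) ∩ (linkV d G)) \ ((delV d F) ∪ (delV d G)))) P' * (if Disjoint P P' then 1 else 0) / (((#σ - #(P ∪ P')).choose (3 - #(P ∪ P')) : ℕ) : ℚ))
      - (∑ P ∈ Q.powerset, ∑ P' ∈ Q.powerset,
          ιq (bySize (· < 3) : Finset (Finset α)) P * ιq (below 2 ((linkV d F) ∩ (linkV d G))) P' * (if Disjoint P P' then 1 else 0) / (((#σ - #(P ∪ P')).choose (3 - #(P ∪ P')) : ℕ) : ℚ))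
      - (∑ P ∈ Q.powerset, ∑ P' ∈ Q.powerset,
          ιq (bySize (· < 2) : Finset (Finset α)) P * ιq (below 3 ((delV d F) ∩ (delV d G))) P' * (if Disjoint P P' then 1 else 0) / (((#σ - #(P ∪ P')).choose (3 - #(P ∪ P')) : ℕ) : ℚ))
      - (∑ P ∈ Q.powerset, ∑ P' ∈ Q.powerset,
          ιq (bySize (· < 2) : Finset (Finset α)) P * ιq (below 2 ((linkV d F) ∩ (linkV d G))) P' * (if Disjoint P P' then 1 else 0) / (((#σ - #(P ∪ P')).choose (3 - #(P ∪ P')) : ℕ) : ℚ))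
      + (∑ P ∈ Q.powerset, ∑ P' ∈ Q.powerset,
          ιq (below 2 (linkV d F)) P * ιq (below 3 (delV d G)) P' * (if Disjoint P P' then 1 else 0) / (((#σ - #(P ∪ P')).choose (3 - #(P ∪ P')) : ℕ) : ℚ))
      + (∑ P ∈ Q.powerset, ∑ P' ∈ Q.powerset,
          ιq (below 3 (delV d F)) P * ιq (below 2 (linkV d G)) P' * (if Disjoint P P' then 1 else 0) / (((#σ - #(P ∪ P')).choose (3 - #(P ∪ P')) : ℕ) : ℚ))
      + (∑ P ∈ Q.powerset, ∑ P' ∈ Q.powerset,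
          ιq (below 2 (linkV d F)) P * ιq (below 2 (linkV d G)) P' * (if Disjoint P P' then 1 else 0) / (((#σ - #(P ∪ P')).choose (3 - #(P ∪ P')) : ℕ) : ℚ))) :
    0 ≤ (Rt 3 F G).coeff (ind σ + Finsupp.single d 2) := by
  have hB := coeff_ind_add_single_two_Rt_three_eq_atomSums F G hd
  -- the three atom sums: bulk (≥ 0) + window (localised)
  have hw3 : ∀ a b c : ℕ, (0 : ℚ) ≤ (fun a b c => if 4 ≤ a + b + c then ∑ t ∈ range 3, (((#σ - a - b - c).choose t : ℕ) : ℚ) *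
          (if b + c < #σ - t then ((((#σ - t : ℕ) : ℚ)) * ((((#σ - t - 1).choose (b + c) : ℕ) : ℚ)))⁻¹ else 0) else 0) a b c := fun a b c => by
    simp only []
    split_ifs
    · exact sum_nonneg fun t _ => mul_nonneg (by positivity) (by split_ifs <;> positivity)
    · exact le_rfl
  have hw2 : ∀ a b c : ℕ, (0 : ℚ) ≤ (fun a b c => if 4 ≤ a + b + c then ∑ t ∈ range 2, (((#σ - a - b - c).choose t : ℕ) : ℚ) *
          (if b + c < #σ - t then ((((#σ - t : ℕ) : ℚ)) * ((((#σ - t - 1).choose (b + c) : ℕ) : ℚ)))⁻¹ else 0) else 0) a b c := fun a b c => by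
    simp only []
    split_ifs
    · exact sum_nonneg fun t _ => mul_nonneg (by positivity) (by split_ifs <;> positivity)
    · exact le_rfl
  obtain ⟨hb1, -, -⟩ := atomSum_del_link_nonneg hF hG hd _ hw3
  obtain ⟨-, hb2, hb3⟩ := atomSum_del_link_nonneg hF hG hd _ hw2
  have hs1 := atomSum_split_four (fun a b c => ∑ t ∈ range 3, (((#σ - a - b - c).choose t : ℕ) : ℚ) *
          (if b + c < #σ - t then ((((#σ - t : ℕ) : ℚ)) * ((((#σ - t - 1).choose (b + c) : ℕ) : ℚ)))⁻¹ else 0)) (linkV d F) (linkV d G) σ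
  have hs2 := atomSum_split_four (fun a b c => ∑ t ∈ range 2, (((#σ - a - b - c).choose t : ℕ) : ℚ) *
          (if b + c < #σ - t then ((((#σ - t : ℕ) : ℚ)) * ((((#σ - t - 1).choose (b + c) : ℕ) : ℚ)))⁻¹ else 0)) (delV d F) (linkV d G) σ
  have hs3 := atomSum_split_four (fun a b c => ∑ t ∈ range 2, (((#σ - a - b - c).choose t : ℕ) : ℚ) *
          (if b + c < #σ - t then ((((#σ - t : ℕ) : ℚ)) * ((((#σ - t - 1).choose (b + c) : ℕ) : ℚ)))⁻¹ else 0)) (linkV d F) (delV d G) σ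
  have hl1 := atomSum_window_three (fun a b c => if 4 ≤ a + b + c then 0 else ∑ t ∈ range 3, (((#σ - a - b - c).choose t : ℕ) : ℚ) *
          (if b + c < #σ - t then ((((#σ - t : ℕ) : ℚ)) * ((((#σ - t - 1).choose (b + c) : ℕ) : ℚ)))⁻¹ else 0)) (fun _ _ _ => 0) (fun _ _ _ => 0) (fun _ _ _ => 0) (fun _ _ _ => 0) σ (linkV d F) (linkV d G)
    (fun a b c h => by simp only [show 4 ≤ a + b + c by omega, if_true]) (fun _ _ _ _ => rfl) (fun _ _ _ _ => rfl) (fun _ _ _ _ => rfl)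
    (fun _ _ _ _ => rfl) hσ
  have hl2 := atomSum_window_three (fun a b c => if 4 ≤ a + b + c then 0 else ∑ t ∈ range 2, (((#σ - a - b - c).choose t : ℕ) : ℚ) *
          (if b + c < #σ - t then ((((#σ - t : ℕ) : ℚ)) * ((((#σ - t - 1).choose (b + c) : ℕ) : ℚ)))⁻¹ else 0)) (fun _ _ _ => 0) (fun _ _ _ => 0) (fun _ _ _ => 0) (fun _ _ _ => 0) σ (delV d F) (linkV d G)
    (fun a b c h => by simp only [show 4 ≤ a + b + c by omega, if_true]) (fun _ _ _ _ => rfl) (fun _ _ _ _ => rfl) (fun _ _ _ _ => rfl)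
    (fun _ _ _ _ => rfl) hσ
  have hl3 := atomSum_window_three (fun a b c => if 4 ≤ a + b + c then 0 else ∑ t ∈ range 2, (((#σ - a - b - c).choose t : ℕ) : ℚ) *
          (if b + c < #σ - t then ((((#σ - t : ℕ) : ℚ)) * ((((#σ - t - 1).choose (b + c) : ℕ) : ℚ)))⁻¹ else 0)) (fun _ _ _ => 0) (fun _ _ _ => 0) (fun _ _ _ => 0) (fun _ _ _ => 0) σ (linkV d F) (delV d G)
    (fun a b c h => by simp only [show 4 ≤ a + b + c by omega, if_true]) (fun _ _ _ _ => rfl) (fun _ _ _ _ => rfl) (fun _ _ _ _ => rfl)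
    (fun _ _ _ _ => rfl) hσ
  -- the pivot term
  have hie := coeff_ie_eq_pairsAt hF hG d σ
  have hbig : (0 : ℚ) ≤ ∑ S ∈ σ.powerset, ((pairsAt (bySize (· < 2) : Finset (Finset α)) (atLeast 3 (((linkV d F) ∩ (linkV d G)) \ ((delV d F) ∪ (delV d G)))) (σ \ S) : ℕ) : ℚ) :=
    sum_nonneg fun S _ => by positivity
  have hm1 : ∀ T ∈ (bySize (· < 2) : Finset (Finset α)), #T ≤ 1 := fun T hT => by
    have := (mem_filter.1 hT).2; omega
  have hm2 : ∀ T ∈ (bySize (· < 3) : Finset (Finset α)), #T ≤ 2 := fun T hT => by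
    have := (mem_filter.1 hT).2; omega
  have hbl : ∀ (K : Finset (Finset α)) (j : ℕ), ∀ T ∈ below j K, #T ≤ j - 1 := fun K j T hT => by
    have := (mem_filter.1 hT).2; omega
  have hp := sum_pairsAt_eq_sum_powersetCard_three (bySize (· < 2) : Finset (Finset α)) (below 3 (((linkV d F) ∩ (linkV d G)) \ ((delV d F) ∪ (delV d G)))) (fun P hP P' hP' => by
    have := hm1 P hP; have := hbl _ 3 P' hP'; omega) σ hσ
  have ht2 := sum_pairsAt_eq_sum_powersetCard_three (bySize (· < 3) : Finset (Finset α)) (below 2 ((linkV d F) ∩ (linkV d G))) (fun P hP P' hP' => by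
    have := hm2 P hP; have := hbl _ 2 P' hP'; omega) σ hσ
  have ht1a := sum_pairsAt_eq_sum_powersetCard_three (bySize (· < 2) : Finset (Finset α)) (below 3 ((delV d F) ∩ (delV d G))) (fun P hP P' hP' => by
    have := hm1 P hP; have := hbl _ 3 P' hP'; omega) σ hσ
  have ht1b := sum_pairsAt_eq_sum_powersetCard_three (bySize (· < 2) : Finset (Finset α)) (below 2 ((linkV d F) ∩ (linkV d G))) (fun P hP P' hP' => by
    have := hm1 P hP; have := hbl _ 2 P' hP'; omega) σ hσ
  have hc1 := sum_pairsAt_eq_sum_powersetCard_three (below 2 (linkV d F)) (below 3 (delV d G)) (fun P hP P' hP' => by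
    have := hbl _ 2 P hP; have := hbl _ 3 P' hP'; omega) σ hσ
  have hc2 := sum_pairsAt_eq_sum_powersetCard_three (below 3 (delV d F)) (below 2 (linkV d G)) (fun P hP P' hP' => by
    have := hbl _ 3 P hP; have := hbl _ 2 P' hP'; omega) σ hσ
  have hc3 := sum_pairsAt_eq_sum_powersetCard_three (below 2 (linkV d F)) (below 2 (linkV d G)) (fun P hP P' hP' => by
    have := hbl _ 2 P hP; have := hbl _ 2 P' hP'; omega) σ hσ
  -- window terms as pair sums
  have hT2 : (((gf (bySize (· < 3) : Finset (Finset α)) * (PiP * gf (below 2 ((linkV d F) ∩ (linkV d G))))).coeff (ind σ) : ℤ) : ℚ) =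
      ∑ S ∈ σ.powerset, ((pairsAt (bySize (· < 3) : Finset (Finset α)) (below 2 ((linkV d F) ∩ (linkV d G))) (σ \ S) : ℕ) : ℚ) := by
    rw [coeff_theta_PiP_gf]; push_cast; rfl
  have hT1 : (((gf (bySize (· < 2) : Finset (Finset α)) * (PiP * (gf (below 3 ((delV d F) ∩ (delV d G))) + gf (below 2 ((linkV d F) ∩ (linkV d G)))))).coeff (ind σ) : ℤ) : ℚ) =
      ∑ S ∈ σ.powerset, ((pairsAt (bySize (· < 2) : Finset (Finset α)) (below 3 ((delV d F) ∩ (delV d G))) (σ \ S) : ℕ) : ℚ)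
      + ∑ S ∈ σ.powerset, ((pairsAt (bySize (· < 2) : Finset (Finset α)) (below 2 ((linkV d F) ∩ (linkV d G))) (σ \ S) : ℕ) : ℚ) := by
    rw [show gf (bySize (· < 2) : Finset (Finset α)) * (PiP * (gf (below 3 ((delV d F) ∩ (delV d G))) + gf (below 2 ((linkV d F) ∩ (linkV d G)))))
        = gf (bySize (· < 2) : Finset (Finset α)) * (PiP * gf (below 3 ((delV d F) ∩ (delV d G)))) + gf (bySize (· < 2) : Finset (Finset α)) * (PiP * gf (below 2 ((linkV d F) ∩ (linkV d G)))) by ring,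
      coeff_add, coeff_theta_PiP_gf, coeff_theta_PiP_gf]
    push_cast; rfl
  have hIE : (((gf (bySize (· < 2) : Finset (Finset α)) * (PiP *
        (gf ((delV d F) ∩ (delV d G)) + gf ((linkV d F) ∩ (linkV d G)) - gf ((delV d F) ∩ (linkV d G)) - gf ((linkV d F) ∩ (delV d G))))).coeff (ind σ) : ℤ) : ℚ) =
      ∑ S ∈ σ.powerset, ((pairsAt (bySize (· < 2) : Finset (Finset α)) (below 3 (((linkV d F) ∩ (linkV d G)) \ ((delV d F) ∪ (delV d G)))) (σ \ S) : ℕ) : ℚ)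
      + ∑ S ∈ σ.powerset, ((pairsAt (bySize (· < 2) : Finset (Finset α)) (atLeast 3 (((linkV d F) ∩ (linkV d G)) \ ((delV d F) ∪ (delV d G)))) (σ \ S) : ℕ) : ℚ) := by
    rw [hie]; push_cast; rfl
  have hsum := sum_nonneg hloc
  simp only [sum_add_distrib, sum_sub_distrib] at hsum
  rw [hs1, hs2, hs3, hl1, hl2, hl3, hIE, hT2, hT1] at hB
  simp only [Int.cast_natCast, sum_add_distrib] at hB
  rw [hp, ht2, ht1a, ht1b, hc1, hc2, hc3] at hB
  have h0 : (0 : ℚ) ≤ (((Rt 3 F G).coeff (ind σ + Finsupp.single d 2) : ℤ) : ℚ) := by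
    rw [hB]
    linarith [hb1, hb2, hb3, hbig]
  exact_mod_cast h0

end Summit.CriticalPhenomena.PercolationContinuityZ3.Theorems.SahiCTCForms
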